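import Mathlib
import Summits.Ventures.PercRepro2.Defs
import Summits.Ventures.PercRepro2.Graph
import Summits.Ventures.PercRepro2.Induced
import Summits.Ventures.PercRepro2.VdBKahn
import Summits.Ventures.PercRepro2.ReimerVdBK
import Summits.Ventures.PercRepro2.ReimerVdBKTwisted
import Summits.Ventures.PercRepro2.ReimerVdBKTied
import Summits.Ventures.PercRepro2.ReimerVdBKCoreDown
import Summits.Ventures.PercRepro2.ReimerVdBKDegTwoCalc
import Summits.Ventures.PercRepro2.ReimerVdBKOuter
import Summits.Ventures.PercRepro2.ReimerVdBKPatch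
import Summits.Ventures.PercRepro2.ReimerVdBKOuterStars
import Summits.Ventures.PercRepro2.ReimerVdBKCellEdges
import Summits.Ventures.PercRepro2.ReimerVdBKCell
import Summits.Ventures.PercRepro2.ReimerVdBKCellCoin

/-!
# The one-coin statement implies (CORE↓) at `N`
(blind cell PercRepro2, mine-c g50; `conjectures/MINE-C.md` §59.3 — part V of the cell theorem)

Summing the one-coin fibre inequalities `OneCoin … N R` over all colourings `c` counts every colouring
exactly `count (coinTied R)` times (the map `c ↦ ω ⊕ c` is an involution; `sum_coinCount`), so the
one-coin statement at `N` implies (CORE↓) at `N` (`coreDown_of_oneCoin`) — the analogue of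
`coreDown_of_outerDown` of `ReimerVdBKOuter` for the finer fibres — and hence (R-1.2) through
`rvdBK_of_coreDown`.  The census of `MINE-C.md` §59.2 holds the one-coin statement for every ADJACENT pair
of revealed vertices of every class (N–N, N–X, N–Y, X–X, Y–Y, X–Y) at every `N` through `n = 6`
exhaustively, so it is a sufficient statement of record beside (OUTER-𝓡).
-/

namespace Summit.Ventures.PercRepro2
namespace ReimerVdBK
open Classical

variable {V : Type*} {E : Type*} [Fintype E] [DecidableEq E] [Fintype V] [DecidableEq V]

section Main
variable (ends : E → Sym2 V) (s : V)

/-- The colourings constant on all the outer edges of `R`. -/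
def coinTied (R : Finset V) : Set (Config E) := shiftTied (fun _ => false) (FE ends R)

/-- Membership in the one-coin fibre is membership of the shifted colouring in the tied set. -/
lemma mem_coinFibre_iff {c : Config E} {R : Finset V} {ω : Config E} :
    ω ∈ coinFibre ends c R ↔ xorC ω c ∈ coinTied ends R := by
  simp only [coinFibre, coinTied, shiftTied, Set.mem_setOf_eq, xorC, Bool.xor_false]

/-- The constant colouring `false` is constant on the outer edges. -/
lemma const_false_mem_coinTied (R : Finset V) : (fun _ => false : Config E) ∈ coinTied ends R :=
  fun _ _ _ _ => rfl

/-- The tied set has a positive count. -/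
lemma count_coinTied_pos (R : Finset V) : 0 < count (coinTied ends R) := by
  unfold count
  refine Finset.sum_pos' (fun ω _ => by split_ifs <;> omega) ⟨(fun _ => false), Finset.mem_univ _, ?_⟩
  rw [if_pos (const_false_mem_coinTied ends R)]
  exact Nat.one_pos

/-- Every colouring lies in exactly `count (coinTied R)` one-coin fibres. -/
lemma sum_mem_coinFibre (R : Finset V) (ω : Config E) :
    ∑ c : Config E, (if ω ∈ coinFibre ends c R then (1 : ℕ) else 0) = count (coinTied ends R) := by
  unfold count
  rw [← sum_xorC ω (fun d => if d ∈ coinTied ends R then (1 : ℕ) else 0)]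
  refine Finset.sum_congr rfl fun c _ => ?_
  simp only [mem_coinFibre_iff]

variable (A X B Y N R : Finset V)

/-- Summing the coin counts over all colourings `c` counts the core-restricted count `count (coinTied R)`
times. -/
lemma sum_coinCount :
    ∑ c : Config E, coinCount ends s A X B Y N R c = count (coinTied ends R) * coreCount ends s A X B Y N := by
  unfold coinCount
  rw [Finset.sum_comm, coreCount_eq_sum_coreAvoid, Finset.mul_sum]
  refine Finset.sum_congr rfl fun ω _ => ?_
  by_cases h : ω ∈ twoWorld ends s A X B Y ∧ CoreAvoid ends s N ω
  · rw [if_pos h, mul_one, ← sum_mem_coinFibre ends R ω]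
    refine Finset.sum_congr rfl fun c _ => ?_
    by_cases hc : ω ∈ coinFibre ends c R
    · rw [if_pos hc, if_pos ⟨h.1, h.2, hc⟩]
    · rw [if_neg hc, if_neg (fun h' => hc h'.2.2)]
  · rw [if_neg h, mul_zero]
    exact Finset.sum_eq_zero fun c _ => if_neg (fun h' => h ⟨h'.1, h'.2.1⟩)

/-- **The one-coin statement at `N` implies (CORE↓) at `N`**, for every revealed set `R`. -/
theorem coreDown_of_oneCoin (h : OneCoin ends s A X B Y N R) : CoreDown ends s A X B Y N := by
  unfold CoreDown
  have hsum : ∑ c : Config E, coinCount ends s A X B Y N R c ≤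
      ∑ c : Config E, coinCount ends s (A ∪ B) ∅ ∅ (X ∪ Y) N R c :=
    Finset.sum_le_sum fun c _ => h c
  rw [sum_coinCount, sum_coinCount] at hsum
  exact Nat.le_of_mul_le_mul_left hsum (count_coinTied_pos ends R)

end Main

end ReimerVdBK
end Summit.Ventures.PercRepro2
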